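import Summits.Ventures.YMGap.Thresholds.StarKernel
import HarnessLib

/-!
# Venture YMGap — track (c) «DS»: STAR GEOMETRY on the torus — which pairs of links share a plaquette
# (the torus-link bookkeeping of the K-row assembly B4, PLAN R95/R96, LEAN-KROW §1 (3)–(4))

HONEST FRAMING: venture file (cell `pub-ymgap`); pure lattice COMBINATORICS of the discrete torus
`(ℤ/L)^d`, no measure, no `β`, no estimate, no clustering/continuum/mass-gap claim. It supplies the
facts the assembly `starWindowBound_lemmaG` (seat ds-4) needs to match the tree's Dobrushin
coefficients `C(e, y) = K (|β|/N) n(e, y)` (`isKRContraction_torusWilson`; `n(e, y)` = the number of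
plaquettes containing both links, `jointPlaq`) with the adjacency pattern of the vertex star used in
the closed-form received sum (`StarGaugeReceivedSum`): on a torus of side `L ≥ 3`, two distinct
links lie on AT MOST ONE common plaquette; two distinct star links lie on exactly one common
plaquette if they are not opposite and on none if they are; a link off the star shares a plaquette
with at most the two star links of the UNIQUE star plaquette containing it (the last two in
`StarAdjacency.lean`, from the parametrization `plaqOf` of the plaquettes through a link given here).

## Contents (`x.shift i = x + e_i`; `L ≥ 3` where stated, otherwise `L ≥ 2` or any `L`)
* site arithmetic: `single_ne_zero'`, `single_inj'`, `signedSingle`,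
  `signedSingle_inj` (`±e_κ = ±e_κ'` forces equal index AND sign when `L ≥ 3`).
* `plaqBase`, `dirPair`, `plaqOf p l κ h pos` — the plaquette through the link `(p, l)` in the plane
  `{l, κ}` on the positive (`pos`, base `p`) or negative (base `p − e_κ`) side;
  `mem_plaqEdgesT_plaqOf` (its four edges), `exists_plaqOf_of_mem` (EVERY plaquette through `(p, l)`
  is one of these), `mem_plaqEdgesT_plaqOf_of_ne`, `plaqOf_eq_of_mem_of_mem`.
  `linkEnds_plaqOf_subset` (its corners).
* `eq_of_two_mem` / `jointPlaq_le_one` — for `L ≥ 3` two distinct links lie on AT MOST ONE common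
  plaquette; `jointPlaq_comm`, `jointPlaq_eq_zero_iff`, `jointPlaq_eq_one_of_mem`,
  `jointPlaq_shift_self_eq_zero` (consecutive collinear links `(p, l)`, `(p + e_l, l)` share none),
  `card_plaqEdgesT` (four distinct edges, `L ≥ 2`).
The star-specific consequences (opposite / non-opposite star links, boundary links, the tree's
`tInfluence`) are in `StarAdjacency.lean`.

References: cell `pub-ymgap` ds/LEAN-KROW.md §1–§2 (formulation B), ds/engine/gauge/GAUGE-STAR.md §4
(the count), PLAN R95/R96; E. Seiler, LNP 159 (1982) Ch. 2 (lattice conventions).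
-/

noncomputable section

open Function Finset
open Literature.MathematicalPhysics.QuantumFieldTheory
open Summit.Ventures.YMGap.DSWindow

namespace Summit.Ventures.YMGap.StarKernel

variable {d L : ℕ}

/-! ### Site arithmetic on `(ℤ/L)^d` -/

section Arith

/-- Unfolding of the shift: `x.shift i = x + e_i`. -/
theorem shift_def (x : Site d L) (i : Fin d) : x.shift i = x + Pi.single i 1 := rfl

/-- `e_i ≠ 0` on a torus of side `≥ 2`. -/
theorem single_ne_zero' (hL : 1 < L) (i : Fin d) : (Pi.single i (1 : ZMod L) : Site d L) ≠ 0 := by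
  haveI : Fact (1 < L) := ⟨hL⟩
  intro h
  have h1 := congr_fun h i
  simp only [Pi.single_eq_same, Pi.zero_apply] at h1
  exact one_ne_zero h1

/-- `e_i = e_j ↔ i = j` on a torus of side `≥ 2`. -/
theorem single_inj' (hL : 1 < L) {i j : Fin d} :
    (Pi.single i (1 : ZMod L) : Site d L) = Pi.single j 1 ↔ i = j := by
  haveI : Fact (1 < L) := ⟨hL⟩
  refine ⟨fun h => ?_, fun h => by rw [h]⟩
  by_contra hij
  have h1 := congr_fun h i
  simp only [Pi.single_eq_same, Pi.single_apply, if_neg hij] at h1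
  exact one_ne_zero h1

/-- The **signed unit vector** `±e_κ`. -/
def signedSingle (κ : Fin d) (pos : Bool) : Site d L :=
  if pos then Pi.single κ 1 else -Pi.single κ 1

/-- The signed unit vector vanishes off its index. -/
theorem signedSingle_apply_of_ne {κ l : Fin d} (h : l ≠ κ) (pos : Bool) :
    (signedSingle κ pos : Site d L) l = 0 := by
  cases pos <;> simp [signedSingle, h]

/-- `±e_κ = ±e_κ'` forces `κ = κ'` and equal signs (torus of side `≥ 3`). -/
theorem signedSingle_inj (hL : 3 ≤ L) {κ κ' : Fin d} {pos pos' : Bool}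
    (h : (signedSingle κ pos : Site d L) = signedSingle κ' pos') : κ = κ' ∧ pos = pos' := by
  haveI : Fact (1 < L) := ⟨by omega⟩
  -- `(1 : ZMod L) ≠ -1` since `L ≥ 3` (else `2 = 0` in `ZMod L`)
  have hne : (1 : ZMod L) ≠ -1 := by
    intro h
    have h2 : (1 : ZMod L) + 1 = 0 :=
      (congrArg (fun t => (1 : ZMod L) + t) h).trans (add_neg_cancel 1)
    have h3 : ((2 : ℕ) : ZMod L) = 0 := by rw [Nat.cast_ofNat, ← one_add_one_eq_two]; exact h2
    have h4 := congrArg ZMod.val h3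
    rw [ZMod.val_natCast, ZMod.val_zero, Nat.mod_eq_of_lt (by omega)] at h4
    omega
  have hκ : κ = κ' := by
    by_contra hκκ
    have h1 := congr_fun h κ
    rw [signedSingle_apply_of_ne hκκ pos'] at h1
    cases pos <;>
      simp only [signedSingle, Bool.false_eq_true, ↓reduceIte, Pi.neg_apply, Pi.single_eq_same,
        neg_eq_zero] at h1 <;>
      exact one_ne_zero h1
  subst hκ
  refine ⟨rfl, ?_⟩
  have h1 := congr_fun h κ
  cases pos <;> cases pos' <;>
    simp only [signedSingle, Bool.false_eq_true, ↓reduceIte, Pi.neg_apply, Pi.single_eq_same] at h1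
  · rfl
  · exact (hne h1.symm).elim
  · exact (hne h1).elim
  · rfl

end Arith

/-! ### The plaquettes through a given link -/

section Param

/-- The ordered direction pair `{l, κ}` of a plaquette. -/
def dirPair (l κ : Fin d) (h : l ≠ κ) : {p : Fin d × Fin d // p.1 < p.2} :=
  if hlt : l < κ then ⟨(l, κ), hlt⟩ else ⟨(κ, l), lt_of_le_of_ne (not_lt.1 hlt) (Ne.symm h)⟩

/-- The base point of `plaqOf p l κ h pos`: `p` on the positive side, `p − e_κ` on the negative. -/
def plaqBase (p : Site d L) (κ : Fin d) (pos : Bool) : Site d L :=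
  if pos then p else p - Pi.single κ 1

/-- **The plaquette through the link `(p, l)` in the plane `{l, κ}` on the side `pos`**: base point
`p` (positive side) or `p − e_κ` (negative side). Every plaquette through `(p, l)` is of this form
(`exists_plaqOf_of_mem`). -/
def plaqOf (p : Site d L) (l κ : Fin d) (h : l ≠ κ) (pos : Bool) : Plaquette d L :=
  (plaqBase p κ pos, dirPair l κ h)

/-- The base shifted by `e_κ` is `p + σe_κ`... precisely: `plaqBase p κ pos + e_κ = p + (e_κ if pos, 0 else)`;
we record the two instances: positive side `p + e_κ`, negative side `p`. -/
theorem plaqBase_shift (p : Site d L) (κ : Fin d) (pos : Bool) :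
    (plaqBase p κ pos).shift κ = if pos then p + Pi.single κ 1 else p := by
  cases pos <;> simp [plaqBase, shift_def]

/-- **The four edges of `plaqOf`**, with `b = plaqBase p κ pos`: `(b, l), (b + e_l, κ), (b + e_κ, l),
(b, κ)` (whatever the order of `l, κ`). -/
theorem mem_plaqEdgesT_plaqOf {p : Site d L} {l κ : Fin d} (h : l ≠ κ) (pos : Bool) {e : Edge d L} :
    e ∈ plaqEdgesT (plaqOf p l κ h pos) ↔
      e = (plaqBase p κ pos, l) ∨ e = ((plaqBase p κ pos).shift l, κ) ∨
        e = ((plaqBase p κ pos).shift κ, l) ∨ e = (plaqBase p κ pos, κ) := by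
  unfold plaqOf dirPair
  by_cases hlt : l < κ
  · rw [dif_pos hlt, mem_plaqEdgesT_mk]
  · rw [dif_neg hlt, mem_plaqEdgesT_mk]
    constructor
    · rintro (h1 | h1 | h1 | h1)
      · exact Or.inr (Or.inr (Or.inr h1))
      · exact Or.inr (Or.inr (Or.inl h1))
      · exact Or.inr (Or.inl h1)
      · exact Or.inl h1
    · rintro (h1 | h1 | h1 | h1)
      · exact Or.inr (Or.inr (Or.inr h1))
      · exact Or.inr (Or.inr (Or.inl h1))
      · exact Or.inr (Or.inl h1)
      · exact Or.inl h1

/-- The link `(p, l)` lies on `plaqOf p l κ h pos`. -/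
theorem self_mem_plaqEdgesT_plaqOf (p : Site d L) {l κ : Fin d} (h : l ≠ κ) (pos : Bool) :
    ((p, l) : Edge d L) ∈ plaqEdgesT (plaqOf p l κ h pos) := by
  rw [mem_plaqEdgesT_plaqOf]
  cases pos
  · exact Or.inr (Or.inr (Or.inl (by rw [plaqBase_shift]; rfl)))
  · exact Or.inl (by simp [plaqBase])

/-- **Every plaquette through the link `(p, l)` is a `plaqOf p l κ h pos`.** -/
theorem exists_plaqOf_of_mem {p : Site d L} {l : Fin d} {q : Plaquette d L}
    (hq : ((p, l) : Edge d L) ∈ plaqEdgesT q) :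
    ∃ (κ : Fin d) (h : l ≠ κ) (pos : Bool), q = plaqOf p l κ h pos := by
  obtain ⟨x, ⟨⟨i, j⟩, hij⟩⟩ := q
  have hne : i ≠ j := hij.ne
  rcases (mem_plaqEdgesT_mk hij).1 hq with h1 | h1 | h1 | h1 <;>
    obtain ⟨rfl, rfl⟩ := Prod.mk.inj h1
  · exact ⟨j, hne, true, by simp [plaqOf, plaqBase, dirPair, hij]⟩
  · refine ⟨i, hne.symm, false, ?_⟩
    simp [plaqOf, plaqBase, dirPair, not_lt.2 hij.le, shift_def]
  · refine ⟨j, hne, false, ?_⟩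
    simp [plaqOf, plaqBase, dirPair, hij, shift_def]
  · exact ⟨i, hne.symm, true, by simp [plaqOf, plaqBase, dirPair, not_lt.2 hij.le]⟩

/-- **Where a second link can sit on `plaqOf p l κ h pos`.** If `y ≠ (p, l)` lies on it, then either
`y` is parallel to `(p, l)` at signed offset `±e_κ` (`y.2 = l`, `y.1 = p ± e_κ`), or `y` has
direction `κ` and base `b` or `b + e_l` (`b` the base point). -/
theorem mem_plaqEdgesT_plaqOf_of_ne {p : Site d L} {l κ : Fin d} (h : l ≠ κ)
    {pos : Bool} {y : Edge d L} (hy : y ∈ plaqEdgesT (plaqOf p l κ h pos)) (hne : y ≠ (p, l)) :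
    (y.2 = l ∧ y.1 = p + signedSingle κ pos) ∨
      (y.2 = κ ∧ (y.1 = plaqBase p κ pos ∨ y.1 = (plaqBase p κ pos).shift l)) := by
  rw [mem_plaqEdgesT_plaqOf] at hy
  rcases hy with rfl | rfl | rfl | rfl
  · -- `(b, l)`: equals `(p, l)` on the positive side, is `(p - e_κ, l)` on the negative side
    cases pos
    · exact Or.inl ⟨rfl, by simp [plaqBase, signedSingle, sub_eq_add_neg]⟩
    · exact absurd (by simp [plaqBase]) hne
  · exact Or.inr ⟨rfl, Or.inr rfl⟩
  · cases pos
    · exact absurd (by rw [plaqBase_shift]; rfl) hne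
    · exact Or.inl ⟨rfl, by simp [plaqBase, signedSingle, shift_def]⟩
  · exact Or.inr ⟨rfl, Or.inl rfl⟩

/-- **Two plaquettes through `(p, l)` sharing a second link coincide** (torus of side `≥ 3`). -/
theorem plaqOf_eq_of_mem_of_mem (hL : 3 ≤ L) {p : Site d L} {l κ κ' : Fin d} {h : l ≠ κ}
    {h' : l ≠ κ'} {pos pos' : Bool} {y : Edge d L} (hne : y ≠ (p, l))
    (hy : y ∈ plaqEdgesT (plaqOf p l κ h pos)) (hy' : y ∈ plaqEdgesT (plaqOf p l κ' h' pos')) :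
    plaqOf p l κ h pos = plaqOf p l κ' h' pos' := by
  haveI : Fact (1 < L) := ⟨by omega⟩
  rcases mem_plaqEdgesT_plaqOf_of_ne h hy hne with ⟨h1, h2⟩ | ⟨h1, h2⟩ <;>
    rcases mem_plaqEdgesT_plaqOf_of_ne h' hy' hne with ⟨h1', h2'⟩ | ⟨h1', h2'⟩
  · -- both parallel: the signed offsets agree
    rw [h2, add_right_inj] at h2'
    obtain ⟨rfl, rfl⟩ := signedSingle_inj hL h2'
    rfl
  · exact absurd (h1.symm.trans h1') h'
  · exact absurd (h1'.symm.trans h1) h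
  · -- both of direction `κ = κ'`: the side is read off the `κ`-coordinate of the base point
    have hκ : κ = κ' := h1.symm.trans h1'
    subst hκ
    suffices hp : pos = pos' by subst hp; rfl
    cases pos <;> cases pos' <;> first | rfl | skip
    all_goals
      exfalso
      rcases h2 with h2 | h2 <;> rcases h2' with h2' | h2' <;>
      · have h3 := congr_fun (sub_eq_zero.2 (h2.symm.trans h2')) κ
        simp [plaqBase, shift_def, Ne.symm h] at h3

/-- The corners of `plaqOf p l κ h pos` off the link `(p, l)`: an endpoint `v` of one of its edges is
`p`, `p + e_l`, `p + σe_κ` or `p + e_l + σe_κ` (`σe_κ = signedSingle κ pos`). -/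
theorem linkEnds_plaqOf_subset {p : Site d L} {l κ : Fin d} (h : l ≠ κ) (pos : Bool) {e : Edge d L}
    (he : e ∈ plaqEdgesT (plaqOf p l κ h pos)) {v : Site d L} (hv : v ∈ linkEnds e) :
    v = p ∨ v = p + Pi.single l 1 ∨ v = p + signedSingle κ pos ∨
      v = p + Pi.single l 1 + signedSingle κ pos := by
  rw [mem_linkEnds] at hv
  rw [mem_plaqEdgesT_plaqOf] at he
  rcases he with rfl | rfl | rfl | rfl <;> rcases hv with rfl | rfl <;> cases pos
  · exact Or.inr (Or.inr (Or.inl (by simp only [plaqBase, signedSingle, Bool.false_eq_true, ↓reduceIte]; abel)))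
  · exact Or.inl (by simp only [plaqBase, ↓reduceIte])
  · exact Or.inr (Or.inr (Or.inr (by simp only [plaqBase, signedSingle, shift_def, Bool.false_eq_true, ↓reduceIte]; abel)))
  · exact Or.inr (Or.inl (by simp only [plaqBase, shift_def, ↓reduceIte]))
  · exact Or.inr (Or.inr (Or.inr (by simp only [plaqBase, signedSingle, shift_def, Bool.false_eq_true, ↓reduceIte]; abel)))
  · exact Or.inr (Or.inl (by simp only [plaqBase, shift_def, ↓reduceIte]))
  · exact Or.inr (Or.inl (by simp only [plaqBase, shift_def, Bool.false_eq_true, ↓reduceIte]; abel))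
  · exact Or.inr (Or.inr (Or.inr (by simp only [plaqBase, signedSingle, shift_def, ↓reduceIte])))
  · exact Or.inl (by simp only [plaqBase, shift_def, Bool.false_eq_true, ↓reduceIte]; abel)
  · exact Or.inr (Or.inr (Or.inl (by simp only [plaqBase, signedSingle, shift_def, ↓reduceIte])))
  · exact Or.inr (Or.inl (by simp only [plaqBase, shift_def, Bool.false_eq_true, ↓reduceIte]; abel))
  · exact Or.inr (Or.inr (Or.inr (by simp only [plaqBase, signedSingle, shift_def, ↓reduceIte]; abel)))
  · exact Or.inr (Or.inr (Or.inl (by simp only [plaqBase, signedSingle, Bool.false_eq_true, ↓reduceIte]; abel)))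
  · exact Or.inl (by simp only [plaqBase, ↓reduceIte])
  · exact Or.inl (by simp only [plaqBase, shift_def, Bool.false_eq_true, ↓reduceIte]; abel)
  · exact Or.inr (Or.inr (Or.inl (by simp only [plaqBase, signedSingle, shift_def, ↓reduceIte])))

end Param

/-! ### Joint-plaquette multiplicities -/

section Joint

variable [NeZero L]

/-- `jointPlaq` is symmetric (both count the plaquettes containing the two links). -/
theorem jointPlaq_comm (x y : Edge d L) : jointPlaq x y = jointPlaq y x := by
  unfold jointPlaq
  congr 1
  ext q
  simp only [mem_filter, mem_plaqsThrough]
  exact and_comm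

/-- `jointPlaq x y = 0` iff no plaquette contains both links. -/
theorem jointPlaq_eq_zero_iff {x y : Edge d L} :
    jointPlaq x y = 0 ↔ ∀ q, x ∈ plaqEdgesT q → y ∉ plaqEdgesT q := by
  rw [jointPlaq, card_eq_zero, filter_eq_empty_iff]
  simp only [mem_plaqsThrough]

omit [NeZero L] in
/-- **Two distinct links lie on at most one common plaquette** (torus of side `≥ 3`): two
plaquettes containing both coincide. -/
theorem eq_of_two_mem (hL : 3 ≤ L) {x y : Edge d L} (hxy : x ≠ y) {q q' : Plaquette d L}
    (hx : x ∈ plaqEdgesT q) (hy : y ∈ plaqEdgesT q) (hx' : x ∈ plaqEdgesT q')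
    (hy' : y ∈ plaqEdgesT q') : q = q' := by
  obtain ⟨p, l⟩ := x
  obtain ⟨κ, h, pos, rfl⟩ := exists_plaqOf_of_mem hx
  obtain ⟨κ', h', pos', rfl⟩ := exists_plaqOf_of_mem hx'
  exact plaqOf_eq_of_mem_of_mem hL hxy.symm hy hy'

/-- `jointPlaq x y ≤ 1` for distinct links on a torus of side `≥ 3`. -/
theorem jointPlaq_le_one (hL : 3 ≤ L) {x y : Edge d L} (hxy : x ≠ y) : jointPlaq x y ≤ 1 := by
  rw [jointPlaq]
  refine card_le_one.2 fun q hq q' hq' => ?_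
  rw [mem_filter, mem_plaqsThrough] at hq hq'
  exact eq_of_two_mem hL hxy hq.1 hq.2 hq'.1 hq'.2

/-- A plaquette has exactly four edges (torus of side `≥ 2`). -/
theorem card_plaqEdgesT (hL : 1 < L) (q : Plaquette d L) : (plaqEdgesT q).card = 4 := by
  have h12 := Balaban1983to89.StrongCouplingTorusWindow.tLink1_ne_tLink2 q
  have h13 := Balaban1983to89.StrongCouplingTorusWindow.tLink1_ne_tLink3 hL q
  have h14 := Balaban1983to89.StrongCouplingTorusWindow.tLink1_ne_tLink4 q
  have h23 := Balaban1983to89.StrongCouplingTorusWindow.tLink2_ne_tLink3 q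
  have h24 := Balaban1983to89.StrongCouplingTorusWindow.tLink2_ne_tLink4 hL q
  have h34 := Balaban1983to89.StrongCouplingTorusWindow.tLink3_ne_tLink4 q
  rw [Balaban1983to89.StrongCouplingTorusWindow.plaqEdgesT_eq,
    card_insert_of_notMem (by simp [h12, h13, h14]), card_insert_of_notMem (by simp [h23, h24]),
    card_pair h34]

/-- `jointPlaq x y = 1` on a torus of side `≥ 3` as soon as some plaquette contains both (distinct)
links. -/
theorem jointPlaq_eq_one_of_mem (hL : 3 ≤ L) {x y : Edge d L} (hxy : x ≠ y) {q : Plaquette d L}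
    (hx : x ∈ plaqEdgesT q) (hy : y ∈ plaqEdgesT q) : jointPlaq x y = 1 := by
  refine le_antisymm (jointPlaq_le_one hL hxy) ?_
  rw [jointPlaq, Nat.one_le_iff_ne_zero, Ne, card_eq_zero, ← Ne, ← nonempty_iff_ne_empty]
  exact ⟨q, mem_filter.2 ⟨mem_plaqsThrough.2 hx, hy⟩⟩

/-- **Consecutive collinear links share no plaquette**: `(p, l)` and `(p + e_l, l)` (side `≥ 2`). -/
theorem jointPlaq_shift_self_eq_zero (hL : 1 < L) (p : Site d L) (l : Fin d) :
    jointPlaq ((p, l) : Edge d L) (p.shift l, l) = 0 := by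
  haveI : Fact (1 < L) := ⟨hL⟩
  rw [jointPlaq_eq_zero_iff]
  intro q hq hy
  obtain ⟨κ, h, pos, rfl⟩ := exists_plaqOf_of_mem hq
  have hne : ((p.shift l, l) : Edge d L) ≠ (p, l) := fun h' =>
    Balaban1983to89.StrongCouplingTorusWindow.shift_ne_self hL p l (Prod.mk.inj h').1
  rcases mem_plaqEdgesT_plaqOf_of_ne h hy hne with ⟨-, h2⟩ | ⟨h1, -⟩
  · have h3 := congr_fun (sub_eq_zero.2 h2) κ
    rw [signedSingle] at h3
    cases pos <;> simp [shift_def, Ne.symm h] at h3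
  · exact h h1

end Joint

end Summit.Ventures.YMGap.StarKernel

end
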